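import Summits.QuantumFields.YangMills.Theorems.BalabanUVNodesK0Stub1MultiplierO1LetterAtRecord
import HarnessLib

/-!
# K0⁷ STUB 1 (`stub_prop8StepCoP13`), sub-target S4b — **THE `h₀` LETTER ((46)ᵀ) FOR THE TRANSPOSE OF THE FLAT RIGHT INVERSE `H = GQ*(QGQ*)⁻¹` AT EVERY INDEX BOND**:
# `1·‖(Hᵗ Z)(t)‖ ≤ h₀·s` whenever `w₃(b)·‖Z b‖ ≤ s` on the fine bonds, for every transpose `Hᵗ` (w.r.t. `BE = η^dΣ_b τ`, `B = Σ_t τ`) of a block-diagonally rescaled flat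
# `H_V∘diag(ν)`, `|ν_t| ≤ (L^{j(t)}η)⁻¹` (p598821's `Hᵗ_V`: `ν ≡ 1`; the ♭-rescaled right inverse `H_V∘((Lʲη)⁻¹•·)` of print's `(Lʲη)•Q_V`: `ν_t = (L^{j(t)}η)⁻¹`), with ONE
# constant `h₀` depending on `L` only — [B6] Cor. 2.8 (2.151)₁ (port pad, kernel decay of `H`) + the fine bonds of a block (`(Lʲ)^{D}·D`) + the level absorption (2.60) +
# Lemma 2.1 (2.61)

Cell `pub-ymgap`, width seat `pub-ymgap-k0-s1-w4` g0′ (FILE 8).  `--kind proof --supports stmt-QuantumFields-20541 --as helper`; count-neutral.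
[15] = [Balaban1985Variational]; [B6] = [Balaban1984PropagatorsII].

WHY.  The S4b capstone at the record (p612123, `_anyQ` edition) displays `h₀`: `(∀ b, w 3 b·‖Z b‖ ≤ s) → ∀ i, wB′ i·‖Hᵗ Z i‖ ≤ h₀·s` for the transpose `Hᵗ` of its
right inverse `H`.  On the flat∕straight road (this seat's FILEs 4–6: `wB′ ≡ 1`, `O₁`, `q₀ = 2`, `q = L`; readings (R1)∕(R1′) of LOCATED-Q0-COMB ∕ LOCATED-BASEPOINT) the
right inverse of print's `(Lʲη)•Q_V` is the FLAT `H_V` rescaled by `(Lʲη)⁻¹` on its block argument, so `Hᵗ` has the kernel `(Hᵗ Z)(t) = η^d·ν_t·Σ_b H(b,t)•Z_b` with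
`|ν_t| ≤ (L^{j(t)}η)⁻¹`.  The column at `t`: `|H(b,t)| ≤ C₁e^{−δ(d_T(y(b),βt)+3)}` ((2.151)₁ through k0-s1-w3's port `K0FlatPortHRows12P.hRows12_of_cor28Shape`); the fine bonds of
a block `y′` of level `j′` number `≤ D·(L^{j′})^{D}` and carry `w₃ = (L^{j′}η)³`, so they weigh `η^{D}·D(L^{j′})^{D}(L^{j′}η)^{−3} = D(L^{j′}η)^{D−3} ≤ D·(L^{j′}η)` (`D = 4`); against
`ν_t ≤ (L^{j(t)}η)⁻¹` this is `D·L^{j′−j(t)} ≤ D·L^{|j′−j(t)|} ≤ D·L·e^{(δ∕8)d_T}` ((2.60), `powL_lgap_le`), and Lemma 2.1 (2.61) at rate `δ∕2` sums the blocks.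

WHAT IS PROVED (sorry-free; no definition; axioms standard).
* §1 `card_fiber_blkV1_le_level` (at most `(d+1)·(L^{j(y)})^{d+1}` fine bonds share the block `y` — the level-sharp twin of lit-balaban `card_fiber_blkV1_le`);
  `sum_fine_comp_blkV1_le` (a fine-bond sum of a block function against the block count).
* §2 ★★ `flatHColSum_domT` — at every charted family of `PV d ℓ m K` with `d + 1 = 4`: `Mh₀, R₀`, `h₀ ≥ 0` (functions of `L`) with
  `(L^{j(t)}η)⁻¹·η⁴·Σ_b (w 3 b)⁻¹·|(flatH e_t)(b)| ≤ h₀` for every (152) weight family and EVERY index bond `t`.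
* §3 ★★ `flatHColSum_of_adm22` (every `Adm22 D R (L·M_h)` family, level-0 chart) · `flatHColSum_of_adm22_T4` · ★★★ `h46t_unitWeight_of_adm22_T4` — for every `F : T4Family`:
  `Mh₀, R₀, h₀` such that at every admissible family in the standing range, every normed `ℂ`-space fibre, every `ν` with `|ν_t| ≤ (L^{j(t)}η)⁻¹` and every `Hᵗ` with the kernel
  `(Hᵗ Z)(t) = ((η:ℂ)^d·ν_t)•Σ_b (flatH e_t)(b)•Z_b`: `(∀ b, w 3 b·‖Z b‖ ≤ s) → ∀ t, 1·‖Hᵗ Z t‖ ≤ h₀·s` (`0 ≤ s`) — the capstone's `h46t` AS DISPLAYED at `wB′ ≡ 1`.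
HONEST SCOPE.  Bookkeeping over k0-s1-w3's port pads and lit-balaban's hypothesis-free [B6] chain; the letter is for the transpose of the FLAT `H_V` (and its block rescalings), NOT
for the transpose of the corrected right inverse `H₀X̃′ + dφ` of the single-bar `Qlin` (k0-s1-w1's), whose comb part needs its own column analysis; which `H` the capstone finally
carries is the S2∕S4 lanes' decision; nothing of Bałaban's analysis asserted beyond the cited kernel theorems; `stub_prop8StepCoP13` ∕ K0⁷ NOT closed; N07 NOT discharged; counts
unmoved (28∕28 · 5∕27); R4 closes the conditional finite-𝕋⁴ rung `BalabanLadder.UV` only, never the summit; the YM mass gap (Clay) is NOT proved by any of this; nothing continuum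
∕ ℝ⁴ ∕ OS.  No `sorry`, no `def`, no `instance`, no `notation`.
References: [15] (45)–(46) p.285, (152) p.301, (157) p.302, (161)–(162) p.303; [B6] (2.1)–(2.2) p.224, (2.35) p.228, Lemma 2.1 (2.59)–(2.61) pp.233–234, (2.45) p.231, Cor. 2.8
(2.150)–(2.151) p.249; [Balaban1987RG1] (0.1) p.251.
-/

set_option autoImplicit false

noncomputable section

open scoped BigOperators InnerProductSpace

namespace Summit.QuantumFields.YangMills.Theorems.K0Stub1FlatHTransposeLetterAtRecord

open K0FlatPortBudgetsP (theta_budget absorb_budget chart_params)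
open K0FlatPortKernelRowsP (unitWeights_pos globalBand_unitWeights)
open K0FlatPortHRows12P (hRows12_of_cor28Shape)
open Literature.MathematicalPhysics.QuantumFieldTheory.Balaban1983to89
open Literature.MathematicalPhysics.QuantumFieldTheory.Balaban1983to89.T4Continuum (T4Family)
open B6MultiLevelBoxOperator (N0)
open B6MultiLevelTorusOperatorL0 (TDomains)
open B6Geom246MultiLevelBoxL0 (bset blkOf)
open B6Geom246MultiLevelTorusL0 (geomT bondT lemma21_torus)
open B6GlobalChartV1 (PV toBox toBox_injective)
open B6GlobalChartV1L0 (domT blkV1)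
open B6Ineq2142KLevelV1L0 (lvl lvl_le β beta_level)
open B6RandomWalk (delta3 delta3_pos)
open B6Ineq261LevelGap (K261 K261_nonneg)
open B6QGQCoerciveMultiLevelBoxL0 (nb filter_blkOf_eq_image)
open B4Reflection242 (boxDom)
open B6SectADomainsV1 (Domains)
open B6SectAOperatorsV1 (BondIdx)
open B6Cor28KLevelV1L0 (powL_lgap_le)
open B6Ineq281MultiLevelBoxL0 (lgap)
open B6Prop23MultiLevelTorusL0 (isPseudoDist_distT)
open FlatPortHRows12 (cf_ne_zero)
open FlatPortCor28PadL0 (cor28_kLevel_H_DH_pad)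
open FlatPortRowSum (pow_div_pow_le_pow_natAbs)
open FlatPortDistanceL0 (levOf_domT blkV1_level)
open Summit.QuantumFields.YangMills.Theorems.FlatCubeOpsText (Adm22)
open Summit.QuantumFields.YangMills.Theorems.K0FlatCubeOpsTextP (IsLevWeight flatH)

/-! ## §1  The fine bonds of a block -/

section Carrier

variable {d ℓ m K : ℕ} {hd : 1 ≤ d + 1} {hL : Odd (ℓ + 1) ∧ 1 < ℓ + 1} {Mh k R : ℕ} {P' : Fin (d + 1) → ℕ}
variable (hN : ∀ μ, N0 ℓ Mh k P' μ = (PV d ℓ m K hd hL).sitesPerDir 0) (D : TDomains d ℓ Mh k P' R)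

/-- **AT MOST `(d+1)·(L^{j(y)})^{d+1}` FINE BONDS SHARE THE BLOCK `y`** (the level-sharp twin of lit-balaban `B16Ineq17WholeTorusMajorants.card_fiber_blkV1_le`: a bond is `(b₋, μ)`,
`toBox` is injective, `Bʲ(y)` is the image of its chart `filter_blkOf_eq_image`, `#Bʲ(y) = (Lʲ)^{d+1}`). [cite: Balaban1984PropagatorsII, (2.1) p.224, (2.45) p.231 (bookkeeping)] -/
theorem card_fiber_blkV1_le_level (y : (geomT D).Site) (s : Finset (PBond (PV d ℓ m K hd hL) 0)) (hs : ∀ f ∈ s, blkV1 hN D f = y) :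
    s.card ≤ (d + 1) * ((ℓ + 1) ^ y.1.1) ^ (d + 1) := by
  classical
  set code : PBond (PV d ℓ m K hd hL) 0 → ↥(boxDom (N0 ℓ Mh k P')) × Fin (d + 1) := fun b => (toBox hN b.src, b.dir) with hcode
  have hinj : Set.InjOn code ↑s := by
    intro b _ b' _ h
    simp only [hcode, Prod.mk.injEq] at h
    obtain ⟨h1, h2⟩ := h
    have hsrc : b.src = b'.src := toBox_injective hN h1
    cases b; cases b'
    simp only at hsrc h2
    rw [hsrc, h2]
  have himg : s.image code ⊆ (Finset.univ.filter fun x : ↥(boxDom (N0 ℓ Mh k P')) => blkOf D.toDomains x = y) ×ˢ Finset.univ := by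
    intro p hp
    obtain ⟨b, hb, rfl⟩ := Finset.mem_image.1 hp
    simp only [hcode, Finset.mem_product, Finset.mem_filter, Finset.mem_univ, true_and, and_true]
    exact hs b hb
  have hblk : (Finset.univ.filter fun x : ↥(boxDom (N0 ℓ Mh k P')) => blkOf D.toDomains x = y).card ≤ ((ℓ + 1) ^ y.1.1) ^ (d + 1) := by
    rw [filter_blkOf_eq_image]
    refine Finset.card_image_le.trans ?_
    rw [Finset.card_univ, Fintype.card_fun, Fintype.card_fin, Fintype.card_fin]
    rfl
  calc s.card = (s.image code).card := (Finset.card_image_of_injOn hinj).symm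
    _ ≤ ((Finset.univ.filter fun x : ↥(boxDom (N0 ℓ Mh k P')) => blkOf D.toDomains x = y) ×ˢ (Finset.univ : Finset (Fin (d + 1)))).card :=
        Finset.card_le_card himg
    _ ≤ ((ℓ + 1) ^ y.1.1) ^ (d + 1) * (d + 1) := by
        rw [Finset.card_product, Finset.card_univ, Fintype.card_fin]; exact Nat.mul_le_mul_right _ hblk
    _ = (d + 1) * ((ℓ + 1) ^ y.1.1) ^ (d + 1) := mul_comm _ _

/-- **A FINE-BOND SUM OF A BLOCK FUNCTION**: `Σ_b g(y(b)) ≤ Σ_{y′} (d+1)·(L^{j(y′)})^{d+1}·g(y′)` for `g ≥ 0`. [cite: Balaban1984PropagatorsII, (2.45) p.231 (bookkeeping)] -/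
theorem sum_fine_comp_blkV1_le (g : ↥(bset D.toDomains) → ℝ) (hg : ∀ y, 0 ≤ g y) :
    ∑ b : PBond (PV d ℓ m K hd hL) 0, g (blkV1 hN D b) ≤ ∑ y, ((d + 1 : ℕ) : ℝ) * ((((ℓ + 1 : ℕ) : ℝ) ^ y.1.1) ^ (d + 1)) * g y := by
  classical
  rw [Finset.sum_comp]
  calc ∑ y' ∈ Finset.univ.image (blkV1 hN D), (Finset.univ.filter fun b => blkV1 hN D b = y').card • g y'
      ≤ ∑ y' ∈ Finset.univ.image (blkV1 hN D), ((d + 1 : ℕ) : ℝ) * ((((ℓ + 1 : ℕ) : ℝ) ^ y'.1.1) ^ (d + 1)) * g y' := Finset.sum_le_sum fun y' _ => by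
        rw [nsmul_eq_mul]
        refine mul_le_mul_of_nonneg_right ?_ (hg y')
        have h := card_fiber_blkV1_le_level hN D y' (Finset.univ.filter fun b => blkV1 hN D b = y') (fun f hf => (Finset.mem_filter.1 hf).2)
        exact_mod_cast h
    _ ≤ ∑ y', ((d + 1 : ℕ) : ℝ) * ((((ℓ + 1 : ℕ) : ℝ) ^ y'.1.1) ^ (d + 1)) * g y' :=
        Finset.sum_le_sum_of_subset_of_nonneg (Finset.subset_univ _) fun y' _ _ => mul_nonneg (by positivity) (hg y')

end Carrier

/-! ## §2  ★★ The column of the flat `H` against the (152) weights, at every charted family (`d + 1 = 4`) -/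

/-- ★★ **THE COLUMN OF THE FLAT `H` AGAINST THE LEVEL WEIGHTS, AT A CHARTED FAMILY OF A FOUR-TORUS**: for odd `L = ℓ + 1 ≥ 5` there are `Mh₀, R₀` and `h₀ ≥ 0` (functions of
`L`) such that in the standing range, for every (152) weight family `w` and EVERY index bond `t`:
`(L^{j(t)}η)⁻¹·η⁴·Σ_b (w 3 b)⁻¹·|(flatH e_t)(b)| ≤ h₀` — (2.151)₁ at the port pad's unit band (`hRows12_of_cor28Shape`), the fine bonds of each block (§1), the level absorption
(2.60) (`powL_lgap_le`, rate `δ₅∕8`) and Lemma 2.1 (2.61) at rate `δ₅∕2`; `h₀ = C₅e^{3δ₅}·4L·K₂.₆₁`.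
[cite: Balaban1984PropagatorsII, Cor. 2.8 (2.151) p.249, Lemma 2.1 (2.59)-(2.61) pp.233-234, (2.45) p.231; Balaban1985Variational, (46) p.285, (152) p.301] -/
theorem flatHColSum_domT (ℓ : ℕ) (hL : Odd (ℓ + 1) ∧ 1 < ℓ + 1) (hℓ : 4 ≤ ℓ) :
    ∃ (Mh₀ R₀ : ℕ) (h₀ : ℝ), 0 ≤ h₀ ∧
    ∀ (m : ℕ) (n K : ℕ) {Mh R : ℕ} {P' : Fin (3 + 1) → ℕ} (hN : ∀ μ, N0 ℓ Mh (K - n) P' μ = (PV 3 ℓ m K K0FlatCubeOpsTextP.hd4 hL).sitesPerDir 0)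
      (D : TDomains 3 ℓ Mh (K - n) P' R) (hk : K - n ≤ m + K) (_ : 1 ≤ K - n) (_ : K - n + 1 ≤ m + K)
      {P'' : Fin (3 + 1) → ℕ} (_ : ∀ μ, P' μ = (ℓ + 1) * P'' μ) (_ : ∀ μ, 5 ≤ P'' μ)
      {a : ℕ} (_ : Mh = (ℓ + 1) ^ a) (_ : Mh₀ ≤ Mh) (_ : R₀ ≤ R)
      (w : ℕ → PBond (PV 3 ℓ m K K0FlatCubeOpsTextP.hd4 hL) 0 → ℝ) (_ : IsLevWeight (PV 3 ℓ m K K0FlatCubeOpsTextP.hd4 hL) (K - n) (domT hN D hk) w)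
      (t : BondIdx (domT hN D hk)),
      ((((ℓ + 1 : ℕ) : ℝ)) ^ (t.1.1 : ℕ) * ((((ℓ + 1 : ℕ) : ℝ))⁻¹) ^ (K - n))⁻¹ * ((((ℓ + 1 : ℕ) : ℝ))⁻¹ ^ (K - n)) ^ (3 + 1) *
        ∑ b, (w 3 b)⁻¹ * |flatH (PV 3 ℓ m K K0FlatCubeOpsTextP.hd4 hL) (K - n) (domT hN D hk) (Pi.single t 1) b| ≤ h₀ := by
  classical
  -- [B6] Cor. 2.8 (2.151) at the unit band (port pad)
  obtain ⟨σa, hσa, hA⟩ := cor28_kLevel_H_DH_pad 3 ℓ K0FlatCubeOpsTextP.hd4 hL one_pos (le_refl (1 : ℝ))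
  obtain ⟨δ₅, C₅, M₂a, N₁a, hδ₅, hC₅, hM₂a, hrowsA⟩ := hA σa hσa le_rfl (1 / 2) (by norm_num) (by norm_num)
  -- Lemma-2.1 budget at `(δ₀, α) = (δ₅, 1/2)` and the absorption budget at rate `δ₅/4`
  obtain ⟨hNpos, hθ⟩ := theta_budget 3 ℓ (show 0 < 1 / 2 * δ₅ by positivity)
  set Nr : ℕ := ⌈2 * ((3 + 1 : ℕ) : ℝ) * Real.log ((ℓ : ℝ) + 1) / (1 / 2 * δ₅)⌉₊ + 1 with hNr
  set Na : ℕ := ⌈2 * ((3 : ℝ) + 3) * ((ℓ : ℝ) + 1) / (δ₅ / 4)⌉₊ with hNa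
  set Lr : ℝ := (ℓ : ℝ) + 1 with hLr
  have hL1 : (1 : ℝ) ≤ Lr := by rw [hLr]; linarith [(Nat.cast_nonneg ℓ : (0 : ℝ) ≤ ℓ)]
  have hL0 : (0 : ℝ) < Lr := lt_of_lt_of_le zero_lt_one hL1
  set c261 : ℝ := K261 Nr (3 + 1) Lr 1 (1 / 2 * δ₅) with hc261
  have hc261_0 : 0 ≤ c261 := K261_nonneg hL0.le zero_le_one
  set Mh₀ : ℕ := max 8 ⌈M₂a⌉₊ with hMh₀
  set R₀ : ℕ := max (2 * (ℓ + 1) ^ 2) (max (N₁a + 1) (max (Nr + 1) (Na + 1))) with hR₀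
  refine ⟨Mh₀, R₀, C₅ * Real.exp (3 * δ₅) * (((3 + 1 : ℕ) : ℝ) * Lr) * c261, by positivity, ?_⟩
  intro m n K Mh R P' hN D hk hk1 hk' P'' hLP hP5 a hMha hMh hR w hw t
  -- unpack the thresholds
  have hM8 : 8 ≤ Mh := le_trans (le_max_left _ _) hMh
  have hMh1 : 1 ≤ Mh := le_trans (by norm_num) hM8
  have hR2 : 2 * (ℓ + 1) ^ 2 ≤ R := le_trans (le_max_left _ _) hR
  have hRLM : ∀ {N₁ : ℕ}, N₁ + 1 ≤ R₀ → N₁ + 1 ≤ R * ((ℓ + 1) * Mh) := fun {N₁} h =>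
    le_trans (le_trans h hR) (Nat.le_mul_of_pos_right R (Nat.mul_pos (Nat.succ_pos ℓ) (by omega)))
  have hN₁a' : N₁a + 1 ≤ R * ((ℓ + 1) * Mh) := hRLM (le_trans (le_trans (le_max_left _ _) (le_max_right _ _)) le_rfl)
  have hNr' : Nr + 1 ≤ R * ((ℓ + 1) * Mh) := hRLM (le_trans (le_trans (le_trans (le_max_left _ _) (le_max_right _ _)) (le_max_right _ _)) le_rfl)
  have hNa' : Na + 1 ≤ R * ((ℓ + 1) * Mh) := hRLM (le_trans (le_trans (le_trans (le_max_right _ _) (le_max_right _ _)) (le_max_right _ _)) le_rfl)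
  have hRM1 : 1 ≤ R * ((ℓ + 1) * Mh) := le_trans (by omega) hNr'
  have hM₂a' : M₂a ≤ ((ℓ : ℝ) + 1) * Mh := by
    have h2 : (⌈M₂a⌉₊ : ℝ) ≤ (Mh : ℝ) := by exact_mod_cast le_trans (le_max_right _ _) hMh
    linarith [Nat.le_ceil M₂a, le_mul_of_one_le_left (Nat.cast_nonneg _ : (0 : ℝ) ≤ Mh) hL1]
  have hP1 : ∀ μ, 1 ≤ P' μ := fun μ => by rw [hLP μ]; exact Nat.mul_pos (Nat.succ_pos ℓ) (by have := hP5 μ; omega)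
  -- the port's band weights; (2.151) at these data
  set ws : BondIdx (domT hN D hk) → ℝ := fun i =>
    ((((ℓ + 1 : ℕ) : ℝ)) ^ (K - n) / (((ℓ + 1 : ℕ) : ℝ)) ^ (i.1.1 : ℕ)) ^ 2 * ((((ℓ + 1 : ℕ) : ℝ)) ^ (i.1.1 : ℕ)) ^ (3 + 1) with hws_def
  have hws : ∀ i, 0 < ws i := unitWeights_pos 3 ℓ K0FlatCubeOpsTextP.hd4 hL m n K hN D hk
  have hband := globalBand_unitWeights 3 ℓ K0FlatCubeOpsTextP.hd4 hL m n K hN D hk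
  obtain ⟨hH1, hH2⟩ := hrowsA m K hN D hk hk1 hk' hLP hP5 hMha hM8 hR2 hℓ hM₂a' hN₁a' (cf_ne_zero ℓ n K) hws hband
  have hker : ∀ b : PBond (PV 3 ℓ m K K0FlatCubeOpsTextP.hd4 hL) 0,
      |flatH (PV 3 ℓ m K K0FlatCubeOpsTextP.hd4 hL) (K - n) (domT hN D hk) (Pi.single t 1) b| ≤
        C₅ * Real.exp (3 * δ₅) * Real.exp (-(δ₅ * (((bondT D).dist (blkV1 hN D b) (β hN D hk t) : ℝ) + 3))) := fun b =>
    (hRows12_of_cor28Shape 3 ℓ K0FlatCubeOpsTextP.hd4 hL m n K hN D hk hws hH1 hH2 w hw t (Pi.single t 1) (Pi.single_eq_same t 1)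
      (fun c' hc' => Pi.single_eq_of_ne hc' 1) b).1
  -- Lemma 2.1 (2.61) at rate `δ₅/2` and the level absorption (2.60) at rate `δ₅/8`
  obtain ⟨-, h261, -, -⟩ := lemma21_torus (D := D) hMh1 hP1 hNpos hNr' hδ₅.le (by norm_num : (0 : ℝ) ≤ 1 / 2) (by norm_num : (1 : ℝ) / 2 ≤ 1) hθ
  obtain ⟨-, -, hsm⟩ := absorb_budget 3 ℓ (div_pos hδ₅ four_pos) hNa'
  have hsm' : ((ℓ : ℝ) + 1) ^ 1 * Real.exp (-(δ₅ / 8 * ((R : ℝ) * (((ℓ : ℝ) + 1) * Mh) - 1))) ≤ 1 := by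
    have e : δ₅ / 4 / 2 = δ₅ / 8 := by ring
    rw [e] at hsm; exact hsm
  have habs := powL_lgap_le D hMh1 hP1 hRM1 1 (by positivity : (0 : ℝ) ≤ δ₅ / 8) hsm'
  -- notation
  set η : ℝ := ((((ℓ + 1 : ℕ) : ℝ))⁻¹) ^ (K - n) with hη
  have hcast : (((ℓ + 1 : ℕ) : ℝ)) = Lr := by rw [hLr]; push_cast; ring
  have hη0 : 0 < η := by rw [hη, hcast]; positivity
  have hηL : ∀ j : ℕ, j ≤ K - n → Lr ^ j * η ≤ 1 := fun j hj => by
    rw [hη, hcast, inv_pow, ← div_eq_mul_inv, div_le_one (pow_pos hL0 _)]; exact pow_le_pow_right₀ hL1 hj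
  set yt := β hN D hk t with hyt
  have hjt : (t.1.1 : ℕ) ≤ K - n := lvl_le hN D hk t
  -- the weight of a fine bond is the level weight of its block
  have hηLr : η = (Lr⁻¹) ^ (K - n) := by rw [hη, hcast]
  have hw3 : ∀ b : PBond (PV 3 ℓ m K K0FlatCubeOpsTextP.hd4 hL) 0, w 3 b = (Lr ^ (blkV1 hN D b).1.1 * η) ^ 3 := by
    intro b
    have hlev := levOf_domT (hd := K0FlatCubeOpsTextP.hd4) hN D hk b.src
    rw [hw 3 b, hcast, blkV1_level, hηLr]
    exact congrArg (fun e : ℕ => (Lr ^ e * (Lr⁻¹) ^ (K - n)) ^ 3) hlev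
  -- termwise: `ν_t·η⁴·w₃(b)⁻¹·|H e_t(b)| ≤ [block function](y(b))`
  set g : ↥(bset D.toDomains) → ℝ := fun y' =>
    (Lr ^ (t.1.1 : ℕ) * η)⁻¹ * η ^ (3 + 1) * ((Lr ^ y'.1.1 * η) ^ 3)⁻¹ * (C₅ * Real.exp (3 * δ₅) * Real.exp (-(δ₅ * (((bondT D).dist y' yt : ℝ) + 3)))) with hg
  have hg0 : ∀ y', 0 ≤ g y' := fun y' => by positivity
  have hterm : ∀ b : PBond (PV 3 ℓ m K K0FlatCubeOpsTextP.hd4 hL) 0,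
      (Lr ^ (t.1.1 : ℕ) * η)⁻¹ * η ^ (3 + 1) * ((w 3 b)⁻¹ * |flatH (PV 3 ℓ m K K0FlatCubeOpsTextP.hd4 hL) (K - n) (domT hN D hk) (Pi.single t 1) b|) ≤ g (blkV1 hN D b) := by
    intro b
    rw [hw3 b, hg]
    have hpos : 0 ≤ (Lr ^ (t.1.1 : ℕ) * η)⁻¹ * η ^ (3 + 1) * ((Lr ^ (blkV1 hN D b).1.1 * η) ^ 3)⁻¹ := by positivity
    calc (Lr ^ (t.1.1 : ℕ) * η)⁻¹ * η ^ (3 + 1) * (((Lr ^ (blkV1 hN D b).1.1 * η) ^ 3)⁻¹ * |flatH _ (K - n) (domT hN D hk) (Pi.single t 1) b|)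
        = ((Lr ^ (t.1.1 : ℕ) * η)⁻¹ * η ^ (3 + 1) * ((Lr ^ (blkV1 hN D b).1.1 * η) ^ 3)⁻¹) * |flatH _ (K - n) (domT hN D hk) (Pi.single t 1) b| := by ring
      _ ≤ _ := mul_le_mul_of_nonneg_left (hker b) hpos
  -- blockwise: the fine bonds of `y′` weigh `4·(L^{j′})⁴`, and `η⁴(L^{j′})⁴(L^{j′}η)^{−3}(L^{j(t)}η)^{−1} = L^{j′}/L^{j(t)} ≤ L^{|j′−j(t)|} ≤ L·e^{(δ₅/8)d}`
  have hblock : ∀ y' : ↥(bset D.toDomains), ((3 + 1 : ℕ) : ℝ) * ((((ℓ + 1 : ℕ) : ℝ) ^ y'.1.1) ^ (3 + 1)) * g y' ≤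
      C₅ * Real.exp (3 * δ₅) * (((3 + 1 : ℕ) : ℝ) * Lr) * Real.exp (-(1 / 2 * δ₅ * (geomT D).dist yt y')) := by
    intro y'
    have hj' : y'.1.1 ≤ K - n := (B6Geom246MultiLevelBoxL0.scale_bounds D.toDomains y').2
    set tD : ℝ := ((bondT D).dist y' yt : ℝ) with htD
    have htD0 : 0 ≤ tD := Nat.cast_nonneg _
    have hdist : (geomT D).dist y' yt = tD := rfl
    have hsymm : (geomT D).dist yt y' = tD := by rw [← hdist]; exact (isPseudoDist_distT D hMh1 hP1).symm _ _
    -- the level factor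
    have hlev : ((((ℓ + 1 : ℕ) : ℝ) ^ y'.1.1) ^ (3 + 1)) * ((Lr ^ (t.1.1 : ℕ) * η)⁻¹ * η ^ (3 + 1) * ((Lr ^ y'.1.1 * η) ^ 3)⁻¹) =
        (Lr ^ y'.1.1 * η) ^ 0 * (Lr ^ y'.1.1 / Lr ^ (t.1.1 : ℕ)) := by
      rw [hcast]
      have h1 : Lr ^ y'.1.1 ≠ 0 := pow_ne_zero _ hL0.ne'
      have h2 : Lr ^ (t.1.1 : ℕ) ≠ 0 := pow_ne_zero _ hL0.ne'
      have h3 : η ≠ 0 := hη0.ne'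
      field_simp
    have hgap : Lr ^ y'.1.1 / Lr ^ (t.1.1 : ℕ) ≤ Lr ^ 1 * Real.exp (δ₅ / 8 * tD) := by
      have h1 := pow_div_pow_le_pow_natAbs hL1 y'.1.1 (t.1.1 : ℕ)
      have hlg : lgap D.toDomains y' yt = Int.natAbs ((y'.1.1 : ℤ) - (t.1.1 : ℕ)) := by
        unfold lgap; rw [hyt, beta_level hN D hk t]
      have h2 := habs y' yt
      rw [hlg, pow_one] at h2
      rw [pow_one]
      exact h1.trans (hdist ▸ h2)
    -- the exponential: `e^{−δ(t+3)} ≤ e^{−δ t} = e^{−δ/8 t}·e^{−3δ/8 t}·e^{−δ/2 t}`, `e^{−3δ/8 t} ≤ 1`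
    have hexp : Real.exp (δ₅ / 8 * tD) * Real.exp (-(δ₅ * (tD + 3))) ≤ Real.exp (-(1 / 2 * δ₅ * tD)) := by
      rw [← Real.exp_add, Real.exp_le_exp]; nlinarith [hδ₅.le, htD0]
    calc ((3 + 1 : ℕ) : ℝ) * ((((ℓ + 1 : ℕ) : ℝ) ^ y'.1.1) ^ (3 + 1)) * g y'
        = ((3 + 1 : ℕ) : ℝ) * (((((ℓ + 1 : ℕ) : ℝ) ^ y'.1.1) ^ (3 + 1)) * ((Lr ^ (t.1.1 : ℕ) * η)⁻¹ * η ^ (3 + 1) * ((Lr ^ y'.1.1 * η) ^ 3)⁻¹)) *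
            (C₅ * Real.exp (3 * δ₅) * Real.exp (-(δ₅ * (tD + 3)))) := by rw [hg]; ring
      _ = ((3 + 1 : ℕ) : ℝ) * (Lr ^ y'.1.1 / Lr ^ (t.1.1 : ℕ)) * (C₅ * Real.exp (3 * δ₅) * Real.exp (-(δ₅ * (tD + 3)))) := by rw [hlev, pow_zero, one_mul]
      _ ≤ ((3 + 1 : ℕ) : ℝ) * (Lr ^ 1 * Real.exp (δ₅ / 8 * tD)) * (C₅ * Real.exp (3 * δ₅) * Real.exp (-(δ₅ * (tD + 3)))) :=
          mul_le_mul_of_nonneg_right (mul_le_mul_of_nonneg_left hgap (by positivity)) (by positivity)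
      _ = C₅ * Real.exp (3 * δ₅) * (((3 + 1 : ℕ) : ℝ) * Lr) * (Real.exp (δ₅ / 8 * tD) * Real.exp (-(δ₅ * (tD + 3)))) := by rw [pow_one]; ring
      _ ≤ C₅ * Real.exp (3 * δ₅) * (((3 + 1 : ℕ) : ℝ) * Lr) * Real.exp (-(1 / 2 * δ₅ * tD)) := mul_le_mul_of_nonneg_left hexp (by positivity)
      _ = _ := by rw [hsymm]
  -- assemble
  calc ((((ℓ + 1 : ℕ) : ℝ)) ^ (t.1.1 : ℕ) * ((((ℓ + 1 : ℕ) : ℝ))⁻¹) ^ (K - n))⁻¹ * ((((ℓ + 1 : ℕ) : ℝ))⁻¹ ^ (K - n)) ^ (3 + 1) *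
        ∑ b, (w 3 b)⁻¹ * |flatH (PV 3 ℓ m K K0FlatCubeOpsTextP.hd4 hL) (K - n) (domT hN D hk) (Pi.single t 1) b|
      = ∑ b, (Lr ^ (t.1.1 : ℕ) * η)⁻¹ * η ^ (3 + 1) *
          ((w 3 b)⁻¹ * |flatH (PV 3 ℓ m K K0FlatCubeOpsTextP.hd4 hL) (K - n) (domT hN D hk) (Pi.single t 1) b|) := by rw [hcast, Finset.mul_sum, hηLr]
    _ ≤ ∑ b, g (blkV1 hN D b) := Finset.sum_le_sum fun b _ => hterm b
    _ ≤ ∑ y', ((3 + 1 : ℕ) : ℝ) * ((((ℓ + 1 : ℕ) : ℝ) ^ y'.1.1) ^ (3 + 1)) * g y' := sum_fine_comp_blkV1_le hN D g hg0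
    _ ≤ ∑ y', C₅ * Real.exp (3 * δ₅) * (((3 + 1 : ℕ) : ℝ) * Lr) * Real.exp (-(1 / 2 * δ₅ * (geomT D).dist yt y')) := Finset.sum_le_sum fun y' _ => hblock y'
    _ = C₅ * Real.exp (3 * δ₅) * (((3 + 1 : ℕ) : ℝ) * Lr) * ∑ y', Real.exp (-(1 / 2 * δ₅ * (geomT D).dist yt y')) := by rw [Finset.mul_sum]
    _ ≤ C₅ * Real.exp (3 * δ₅) * (((3 + 1 : ℕ) : ℝ) * Lr) * c261 := mul_le_mul_of_nonneg_left (h261 yt) (by positivity)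

/-! ## §3  Every `Adm22` family, the record's tori, and the capstone's `h46t` -/

/-- ★★ **THE COLUMN OF THE FLAT `H` AT EVERY ADMISSIBLE FAMILY OF A FOUR-TORUS — NO `Ω₁ = T` HYPOTHESIS** (level-0 chart `FlatPortChartL0.tdOfAdmL0` ∕ `domT_tdOfAdmL0`): for odd
`L = ℓ + 1 ≥ 5` there are `Mh₀, R₀`, `h₀ ≥ 0` such that for `1 ≤ K − n`, `K − n + 1 ≤ m + K`, `M = L·M_h`, `M_h = L^{a′} ≥ Mh₀`, `R ≥ R₀`, `a′ + 3 ≤ m + n`, every `D` with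
`D.k = K − n`, `Adm22 D R (L·M_h)`, every (152) weight family and every index bond `t`: `(L^{j(t)}η)⁻¹·η⁴·Σ_b (w 3 b)⁻¹·|(flatH e_t)(b)| ≤ h₀`.
[cite: Balaban1984PropagatorsII, (2.1)-(2.2) p.224, Cor. 2.8 (2.151) p.249, Lemma 2.1 (2.61) p.234; Balaban1985Variational, (46) p.285, (152) p.301] -/
theorem flatHColSum_of_adm22 (ℓ : ℕ) (hL : Odd (ℓ + 1) ∧ 1 < ℓ + 1) (hℓ : 4 ≤ ℓ) :
    ∃ (Mh₀ R₀ : ℕ) (h₀ : ℝ), 0 ≤ h₀ ∧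
    ∀ (m : ℕ) (n K : ℕ) (_ : 1 ≤ K - n) (_ : K - n + 1 ≤ m + K) {Mh R a' : ℕ} (_ : Mh = (ℓ + 1) ^ a') (_ : Mh₀ ≤ Mh) (_ : R₀ ≤ R)
      (_ : a' + 3 ≤ m + n) (D : Domains (PV 3 ℓ m K K0FlatCubeOpsTextP.hd4 hL)) (hDk : D.k = K - n) (_ : Adm22 D R ((ℓ + 1) * Mh))
      (w : ℕ → PBond (PV 3 ℓ m K K0FlatCubeOpsTextP.hd4 hL) 0 → ℝ) (_ : IsLevWeight (PV 3 ℓ m K K0FlatCubeOpsTextP.hd4 hL) (K - n) D w)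
      (t : BondIdx D),
      ((((ℓ + 1 : ℕ) : ℝ)) ^ (t.1.1 : ℕ) * ((((ℓ + 1 : ℕ) : ℝ))⁻¹) ^ (K - n))⁻¹ * ((((ℓ + 1 : ℕ) : ℝ))⁻¹ ^ (K - n)) ^ (3 + 1) *
        ∑ b, (w 3 b)⁻¹ * |flatH (PV 3 ℓ m K K0FlatCubeOpsTextP.hd4 hL) (K - n) D (Pi.single t 1) b| ≤ h₀ := by
  obtain ⟨Mh₀, R₀, h₀, hh₀, hmain⟩ := flatHColSum_domT ℓ hL hℓ
  refine ⟨Mh₀, R₀, h₀, hh₀, ?_⟩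
  intro m n K hk1 hk' Mh R a' hMha hMh hR hsize D hDk hAdm
  have hk : K - n ≤ m + K := by omega
  obtain ⟨hN, hLP, hP5⟩ := chart_params 3 ℓ m n K a' K0FlatCubeOpsTextP.hd4 hL hℓ hk1 hsize
  rw [hMha] at hAdm
  have hN' : ∀ μ : Fin (3 + 1), N0 ℓ Mh (K - n) (fun _ => 2 * (ℓ + 1) ^ (m + n - 1 - a')) μ = (PV 3 ℓ m K K0FlatCubeOpsTextP.hd4 hL).sitesPerDir 0 := by
    rw [hMha]; exact hN
  rw [← hMha] at hAdm
  set D' := FlatPortChartL0.tdOfAdmL0 hN' D hDk hk hAdm with hD'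
  have hEq : domT hN' D' hk = D := FlatPortChartL0.domT_tdOfAdmL0 hN' D hDk hk hAdm
  rw [← hEq]
  exact hmain m n K hN' D' hk hk1 hk' hLP hP5 hMha hMh hR

/-- **THE COLUMN OF THE FLAT `H` ON THE RECORD's TORI** (`T4Family.P K = PV 3 ℓ m K` by `rfl`).
[cite: Balaban1984PropagatorsII, Cor. 2.8 (2.151) p.249, Lemma 2.1 (2.61) p.234; Balaban1987RG1, (0.1) p.251] -/
theorem flatHColSum_of_adm22_T4 (F : T4Family) :
    ∃ (Mh₀ R₀ : ℕ) (h₀ : ℝ), 0 ≤ h₀ ∧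
    ∀ (n K : ℕ) (_ : 1 ≤ K - n) (_ : K - n + 1 ≤ F.m + K) {Mh R a' : ℕ} (_ : Mh = F.L ^ a') (_ : Mh₀ ≤ Mh) (_ : R₀ ≤ R)
      (_ : a' + 3 ≤ F.m + n) (D : Domains (F.P K)) (hDk : D.k = K - n) (_ : Adm22 D R (F.L * Mh))
      (w : ℕ → PBond (F.P K) 0 → ℝ) (_ : IsLevWeight (F.P K) (K - n) D w) (t : BondIdx D),
      (((F.P K).L : ℝ) ^ (t.1.1 : ℕ) * ((((F.P K).L : ℝ))⁻¹) ^ (K - n))⁻¹ * ((((F.P K).L : ℝ))⁻¹ ^ (K - n)) ^ (F.P K).d *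
        ∑ b, (w 3 b)⁻¹ * |flatH (F.P K) (K - n) D (Pi.single t 1) b| ≤ h₀ := by
  obtain ⟨L, hL, h11, m, hm⟩ := F
  obtain ⟨ℓ, rfl⟩ : ∃ ℓ, L = ℓ + 1 := ⟨L - 1, by omega⟩
  have hℓ : 4 ≤ ℓ := by omega
  obtain ⟨Mh₀, R₀, h₀, hh₀, hmain⟩ := flatHColSum_of_adm22 ℓ hL hℓ
  exact ⟨Mh₀, R₀, h₀, hh₀, fun n K hk1 hk' Mh R a' hMha hMh hR hsize D hDk hAdm w hw t => hmain m n K hk1 hk' hMha hMh hR hsize D hDk hAdm w hw t⟩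

section Fibre

variable {ι κ 𝔸 : Type*} [Fintype ι] [Fintype κ] [DecidableEq κ] [NormedRing 𝔸] [NormedAlgebra ℂ 𝔸]

/-- ★ **UNIQUENESS OF THE TRANSPOSE `Hᵗ`**: for a tracial `τ` with dualiser `ρ`, `BE Y δ = c·Σ_b τ(Y_b δ_b)`, `B X X′ = Σ_t τ(X_t X′_t)` and an `H` with a real scalar kernel `h`
(`H X b = Σ_t (h b t)•X_t`), EVERY map `Hᵗ` with `BE Z (H X) = B (Hᵗ Z) X` is the kernel map `(Hᵗ Z)(t) = c•Σ_b (h b t)•Z_b` (test against `X := single t (ρℓ′)`).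
[cite: Balaban1985Variational, (27) p.282, (45)-(46) p.285, (66) p.287] -/
theorem adjointHt_apply_eq_kernel (τ : 𝔸 →L[ℂ] ℂ) (ρ : (𝔸 →L[ℂ] ℂ) →L[ℂ] 𝔸) (hρ : ∀ (ℓ' : 𝔸 →L[ℂ] ℂ) (X : 𝔸), τ (ρ ℓ' * X) = ℓ' X)
    (hτ : ∀ a b : 𝔸, τ (a * b) = τ (b * a)) (c : ℂ)
    {BE : (ι → 𝔸) → (ι → 𝔸) → ℂ} (hBE : ∀ Y δ, BE Y δ = c * ∑ b, τ (Y b * δ b))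
    {B : (κ → 𝔸) → (κ → 𝔸) → ℂ} (hB : ∀ X X', B X X' = ∑ t, τ (X t * X' t))
    {H : (κ → 𝔸) → (ι → 𝔸)} (h : ι → κ → ℝ) (hH : ∀ (X : κ → 𝔸) (b : ι), H X b = ∑ t, ((h b t : ℝ) : ℂ) • X t)
    {Ht : (ι → 𝔸) → (κ → 𝔸)} (hHt : ∀ Z X, BE Z (H X) = B (Ht Z) X) (Z : ι → 𝔸) (t : κ) :
    Ht Z t = c • ∑ b, ((h b t : ℝ) : ℂ) • Z b := by
  refine (SeparatingDual.eq_iff_forall_dual_eq (R := ℂ)).2 fun ℓ' => ?_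
  have key := hHt Z (Pi.single t (ρ ℓ'))
  rw [hBE, hB, Finset.sum_eq_single t (fun t' _ ht' => by rw [Pi.single_eq_of_ne ht', mul_zero, map_zero])
    (fun h' => absurd (Finset.mem_univ _) h'), Pi.single_eq_same, hτ, hρ] at key
  -- left side: `c·Σ_b τ(Z_b · (h b t)•ρℓ′) = c·Σ_b (h b t)·ℓ′(Z_b)`
  have hlhs : ∑ b, τ (Z b * H (Pi.single t (ρ ℓ')) b) = ∑ b, ((h b t : ℝ) : ℂ) * ℓ' (Z b) := by
    refine Finset.sum_congr rfl fun b _ => ?_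
    rw [hH, Finset.sum_eq_single t (fun t' _ ht' => by rw [Pi.single_eq_of_ne ht', smul_zero]) (fun h' => absurd (Finset.mem_univ _) h'),
      Pi.single_eq_same, mul_smul_comm, map_smul, smul_eq_mul, hτ, hρ]
  rw [hlhs] at key
  rw [← key, map_smul, map_sum, smul_eq_mul]
  congr 1
  exact Finset.sum_congr rfl fun b _ => by rw [map_smul, smul_eq_mul]

end Fibre

/-- ★★★ **THE CAPSTONE's `h46t` FOR THE FLAT ∕ ♭-RESCALED `Hᵗ` AT THE RECORD, UNIT BLOCK WEIGHT** — for every `F : T4Family` there are `Mh₀, R₀` and ONE constant `h₀ ≥ 0` such that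
at every admissible family of the record's tori in the standing range, the (152) weights, every normed `ℂ`-space fibre `𝔸`, every rescaling `ν` with `|ν_t| ≤ (L^{j(t)}η)⁻¹`
and every map `Hᵗ` with the kernel `(Hᵗ Z)(t) = ((η:ℂ)^d·ν_t)•Σ_b (flatH e_t)(b)•Z_b` (p598821's `Hᵗ_V`: `ν ≡ 1`; the transpose of the ♭ right inverse `H_V∘((Lʲη)⁻¹•·)`:
`ν_t = (L^{j(t)}η)⁻¹`): `(∀ b, w 3 b·‖Z b‖ ≤ s) → ∀ t, 1·‖Hᵗ Z t‖ ≤ h₀·s` (`0 ≤ s`) — p612123's `h46t` AS DISPLAYED at `wB′ ≡ 1`.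
[cite: Balaban1985Variational, (45)-(46) p.285, (152) p.301, (27) p.282, (66) p.287; Balaban1984PropagatorsII, Cor. 2.8 (2.151) p.249, Lemma 2.1 (2.61) p.234; Balaban1987RG1, (0.1) p.251] -/
theorem h46t_unitWeight_of_adm22_T4 (F : T4Family) :
    ∃ (Mh₀ R₀ : ℕ) (h₀ : ℝ), 0 ≤ h₀ ∧
    ∀ (n K : ℕ) (_ : 1 ≤ K - n) (_ : K - n + 1 ≤ F.m + K) {Mh R a' : ℕ} (_ : Mh = F.L ^ a') (_ : Mh₀ ≤ Mh) (_ : R₀ ≤ R)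
      (_ : a' + 3 ≤ F.m + n) (D : Domains (F.P K)) (hDk : D.k = K - n) (_ : Adm22 D R (F.L * Mh))
      {w : ℕ → PBond (F.P K) 0 → ℝ} (hw : IsLevWeight (F.P K) (K - n) D w)
      {𝔸 : Type*} [SeminormedAddCommGroup 𝔸] [NormedSpace ℂ 𝔸]
      (ν : BondIdx D → ℝ) (_ : ∀ t : BondIdx D, |ν t| ≤ (((F.P K).L : ℝ) ^ (t.1.1 : ℕ) * ((((F.P K).L : ℝ))⁻¹) ^ (K - n))⁻¹)
      (Ht : (PBond (F.P K) 0 → 𝔸) → (BondIdx D → 𝔸))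
      (_ : ∀ (Z : PBond (F.P K) 0 → 𝔸) (t : BondIdx D), Ht Z t =
        (((((((F.P K).L : ℝ))⁻¹ ^ (K - n) : ℝ) : ℂ) ^ (F.P K).d) * ((ν t : ℝ) : ℂ)) • ∑ b, ((flatH (F.P K) (K - n) D (Pi.single t 1) b : ℝ) : ℂ) • Z b)
      (Z : PBond (F.P K) 0 → 𝔸) (s : ℝ) (_ : 0 ≤ s) (_ : ∀ b, w 3 b * ‖Z b‖ ≤ s) (t : BondIdx D),
      (1 : ℝ) * ‖Ht Z t‖ ≤ h₀ * s := by
  classical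
  obtain ⟨Mh₀, R₀, h₀, hh₀, hmain⟩ := flatHColSum_of_adm22_T4 F
  refine ⟨Mh₀, R₀, h₀, hh₀, ?_⟩
  intro n K hk1 hk' Mh R a' hMha hMh hR hsize D hDk hAdm w hw 𝔸 _ _ ν hν Ht hHt Z s hs hZ t
  have hL0 : (0 : ℝ) < ((F.P K).L : ℝ) := by exact_mod_cast (F.P K).L_pos
  set η : ℝ := (((F.P K).L : ℝ))⁻¹ ^ (K - n) with hη
  have hη0 : 0 < η := by positivity
  have hw3 : ∀ b, 0 < w 3 b := fun b => by rw [hw 3 b]; positivity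
  have hcol := hmain n K hk1 hk' hMha hMh hR hsize D hDk hAdm w hw t
  -- `‖Ht Z t‖ = η^d·|ν_t|·‖Σ_b H(b,t)•Z_b‖ ≤ η^d·|ν_t|·Σ_b |H(b,t)|·(s / w₃(b))`
  have hZ' : ∀ b, ‖Z b‖ ≤ (w 3 b)⁻¹ * s := fun b => by
    rw [inv_mul_eq_div, le_div_iff₀ (hw3 b), mul_comm]; exact hZ b
  have hsum : ‖∑ b, ((flatH (F.P K) (K - n) D (Pi.single t 1) b : ℝ) : ℂ) • Z b‖ ≤
      s * ∑ b, (w 3 b)⁻¹ * |flatH (F.P K) (K - n) D (Pi.single t 1) b| := by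
    refine (norm_sum_le _ _).trans ?_
    rw [Finset.mul_sum]
    refine Finset.sum_le_sum fun b _ => ?_
    rw [norm_smul, Complex.norm_real, Real.norm_eq_abs]
    calc |flatH (F.P K) (K - n) D (Pi.single t 1) b| * ‖Z b‖ ≤ |flatH (F.P K) (K - n) D (Pi.single t 1) b| * ((w 3 b)⁻¹ * s) :=
          mul_le_mul_of_nonneg_left (hZ' b) (abs_nonneg _)
      _ = s * ((w 3 b)⁻¹ * |flatH (F.P K) (K - n) D (Pi.single t 1) b|) := by ring
  rw [one_mul, hHt Z t, norm_smul, norm_mul, norm_pow, Complex.norm_real, Complex.norm_real, Real.norm_eq_abs, Real.norm_eq_abs, abs_of_pos hη0]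
  calc η ^ (F.P K).d * |ν t| * ‖∑ b, ((flatH (F.P K) (K - n) D (Pi.single t 1) b : ℝ) : ℂ) • Z b‖
      ≤ η ^ (F.P K).d * (((F.P K).L : ℝ) ^ (t.1.1 : ℕ) * η)⁻¹ * (s * ∑ b, (w 3 b)⁻¹ * |flatH (F.P K) (K - n) D (Pi.single t 1) b|) :=
        mul_le_mul (mul_le_mul_of_nonneg_left (hν t) (by positivity)) hsum (norm_nonneg _) (by positivity)
    _ = ((((F.P K).L : ℝ) ^ (t.1.1 : ℕ) * η)⁻¹ * η ^ (F.P K).d * ∑ b, (w 3 b)⁻¹ * |flatH (F.P K) (K - n) D (Pi.single t 1) b|) * s := by ring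
    _ ≤ h₀ * s := mul_le_mul_of_nonneg_right hcol hs

end Summit.QuantumFields.YangMills.Theorems.K0Stub1FlatHTransposeLetterAtRecord

end
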